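/-
Copyright: the b2b-balaban cell (near-miss cell 7), T⁴-continuum fan-out; row NE7b ROUND-2 swarm, seat
t4-ne7b-formalise-leaf-03 (gen 2) (row S12 «ASSEMBLY», sub-row S12e «THE MULTIPLICITY SOCKET END» of
`t4/b2b-balaban-t4-ne7b-p1/LEAVES-NE7b.md`, ruling R-OWNER-22-24 (2); node A12-I.M of the typer's
`t4/formal/NE7b/DAG.md`).  Released under the licence of the surrounding project.
-/
import Summits.QuantumFields.BalabanUV.T4Continuum.Support.HistoryAssemblyTermsLE
import Summits.QuantumFields.BalabanUV.T4Continuum.Support.HistoryAssemblyPrice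
import Summits.QuantumFields.BalabanUV.T4Continuum.Support.HistoryTransversal

/-!
# History assembly, MULTIPLICITY-KEYED: the numerator read over physical member families, the slot multiplicity a binder

Summits-side support file of the T⁴-continuum cell (rung (B)+1 on a FINITE torus only; NOT infinite volume, NOT the
mass gap, NOT the Clay statement; NOT a proof of the spine estimate NE7b).  Sub-row S12e «THE MULTIPLICITY SOCKET END»
(R-OWNER-22-24 (2)) of row S12, node A12-I.M of the typer's `t4/formal/NE7b/DAG.md`: the KERNEL-side consumer of row
S6g′'s INSTANCE (R-OWNER-22-23: «`#{histories read into (x, G)} ≤ exp((θ_S+θ_a)·F + Ξ)·Λm^{partnerAges}`»).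
[folklore] finite bookkeeping + composition of landed lemmas by name; nothing is quoted from print, nothing printed is
asserted, no `[cite:]` tag, no `Prop`-valued fact minted (trigger c1).

WHY.  In every END of the COUNT road so far (`HistoryAssemblyTermsLE.hybridNE7_of_termReadingLE_canon` and its
pedigree ∕ realised ∕ printed ∕ slack descendants) the live classes are SLOT FAMILIES
(`HistorySocketTH.bstrOf sh mem K τ` = the tree slots `(rootStep, root cell, shape tree)` of the members of `τ`), and
H3's displayed resummation `resum : Σ_{τ ∈ fibre (bstrOf sh mem) T K c} dead K t τ ≤ Rf K c` therefore sums over ALL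
histories whose live skeleton occupies the slot family `c` — over the dead parts AND over the PLACEMENTS of the live
members.  Row S6g′'s count bounds the number of PHYSICAL live members per slot; to let that theorem DISCHARGE A
BINDER the numerator must be read over a finer key — the family of physical (name-free) live members of the term —
and the slot multiplicity must be a named hypothesis.  This file is the generic layer over an ABSTRACT key type `ω`
(`gmem : ℕ → ι → Finset ω`, `gslot : ω → BSlot γ PEv`); `HistoryAssemblyMultRealise` instantiates `ω` by
(root cell, `PGen` with (anchor, region) payloads) for realised pedigrees; `HistoryAssemblyRealiseMult` states the ENDs.

WHAT.  (§0 = `HistoryTransversal.sum_prod_le_prod_sum`, Mathlib only.)  §1 `mem_badTerms_of_bstrOf_eq` (badness is read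
off the slot family), `mem_badTerms_of_mem_fibre`; the fine key: **`badGMems`** (the `gmem`-families of the bad
terms), the GEOMETRIC OCCUPANTS of a tree slot **`gocc`** (the distinct `w ∈ gmem K τ`, `τ` bad, with `gslot w = s`).
§2 the COARSE numerator data built from a fine reading — **`deadC`** (`dead K t τ · FcM K (gmem K τ)`), **`RfC`**
(`Σ_{k ∈ badGMems, k.image gslot = c} FcM K k · RfM K k`) — and the three `Regeneration` fields over `badClasses` ∕
`fibre (bstrOf sh mem)` DERIVED from their fine twins over `badGMems` ∕ `fibre gmem` under the compatibility «slot
family of `gmem K τ` = `bstrOf sh mem K τ`»: **`up_coarse`**, **`deadC_nonneg`**, **`resum_coarse`**.  §3 the SUMMED slot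
price **`ySumG`** (`Σ_{w ∈ gocc s} p K w`) and **`ySumG_le_yT`**: under the per-occupant bound
`#gocc s · p K w ≤ bslotPrice (yT …) s` the summed price is below the labelled price `yT` of `HistoryAssemblyTerms` — so
the exit's `hlabTLE` ∕ `hstr` binders are REUSED verbatim.  §4 **`card_mul_pshapeTH_le_priceT`**: the per-occupant
bound in PRINT's currency from a multiplicity `N ≤ e^{θ·birthLinT sh G′ + Ξ}·Λm^{partnerAges}`, a printed price
`pshapeTH … 1 Λr … κ G′·e^{−Ξ}` with realised cost `κ ≤ costT`, the slack `C.a + θ ≤ ½γ₀A₁²` with profile `≥ 1` at the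
birth steps (row S9b's `pshapeTH_mul_exp_le_shapeTH_of_slack`), and `Λm·Λr ≤ Λ′`.  §5 **`hF_of_multReading`**: the exit's
domination binder for `Fc := 1`, `Rf := RfC`, `y := yT` from the FINE per-family price reading
`FcM K (gmem K τ)·RfM K (gmem K τ) ≤ ∏_{w ∈ gmem K τ} p K w`, `gslot` injective on each `gmem K τ` (§0 + §3).

HONEST DEPENDENCY (cell): continuum YM on T⁴ ⇐ BetaPertH ∧ nine spine estimates (0/9 proved); BetaPertH ⇐ (D1) ∧ (D4)
∧ CAP+tail.  Nothing of H3 ∕ (B) ∕ BetaPertH is discharged here; NE7b is NOT proved; no date.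
-/

open Finset
open Literature.MathematicalPhysics.QuantumFieldTheory.Balaban1983to89
open T4PersistenceDictionary T4PersistentHistoryCount T4BankedInduction T4PrintedShapeBanking
open T4LiveClassFibration T4LiveStructureGas T4BranchingRecordsGas T4TaggedShapeBanking T4PartnerMultiplicity
open Summit.QuantumFields.BalabanUV.T4Continuum.LateMergers
open Summit.QuantumFields.BalabanUV.T4Continuum.HistorySocketTH
open Summit.QuantumFields.BalabanUV.T4Continuum.HistoryAssemblyTerms
open Summit.QuantumFields.BalabanUV.T4Continuum.HistoryAssemblyTermsLE
open Summit.QuantumFields.BalabanUV.T4Continuum.HistoryConstants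
open Summit.QuantumFields.BalabanUV.T4Continuum.HistoryAssemblyPrice
open Summit.QuantumFields.BalabanUV.T4Continuum.HistoryBankingLE
open Summit.QuantumFields.BalabanUV.T4Continuum.HistoryTransversal

namespace Summit.QuantumFields.BalabanUV.T4Continuum.HistoryAssemblyMult

noncomputable section

/-! ## §1 Badness is read off the slot family; the fine key and the geometric occupants -/

section TermData

variable {ε γ ι ω : Type*} [DecidableEq γ] [DecidableEq ω]
variable {sh : ε → PEv} {mem : ℕ → ι → Finset (γ × Gen ε)} {jstar : ℕ → ℕ} {T : ℕ → Finset ι} {K : ℕ}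

omit [DecidableEq ω] in
/-- **BADNESS IS READ OFF THE SLOT FAMILY**: a term with the slot family of a bad term is bad (an old member shows in
the slot's root step). [folklore] -/
theorem mem_badTerms_of_bstrOf_eq {τ τ₀ : ι} (hτ : τ ∈ T K) (hτ₀ : τ₀ ∈ badTerms mem jstar T K)
    (he : bstrOf sh mem K τ = bstrOf sh mem K τ₀) : τ ∈ badTerms mem jstar T K := by
  obtain ⟨-, q₀, hq₀, hold⟩ := mem_badTerms.1 hτ₀
  have h : bslotOf sh q₀ ∈ bstrOf sh mem K τ := by rw [he]; exact mem_image_of_mem _ hq₀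
  obtain ⟨q, hq, hqq⟩ := mem_image.1 h
  refine mem_badTerms.2 ⟨hτ, q, hq, ?_⟩
  have h1 : q.2.rootStep = q₀.2.rootStep := congrArg Sigma.fst hqq
  rw [h1]; exact hold

omit [DecidableEq ω] in
/-- a term in the fibre of a bad (coarse) class is a bad term with that slot family. [folklore] -/
theorem mem_badTerms_of_mem_fibre {c : Finset (BSlot γ PEv)} (hc : c ∈ badClasses sh mem jstar T K) {τ : ι}
    (hτ : τ ∈ fibre (bstrOf sh mem) T K c) : τ ∈ badTerms mem jstar T K ∧ bstrOf sh mem K τ = c := by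
  obtain ⟨τ₀, hτ₀, rfl⟩ := mem_badClasses.1 hc
  obtain ⟨hT, he⟩ := mem_fibre.1 hτ
  exact ⟨mem_badTerms_of_bstrOf_eq hT hτ₀ he, he⟩

variable (mem jstar T)

/-- **THE FINE CLASSES**: the `gmem`-families of the bad terms at cutoff `K` (for the realised reading: the finite sets
of PHYSICAL live members — root cell and name-free genealogy with its regions — of the persistent histories).
[folklore] -/
def badGMems (gmem : ℕ → ι → Finset ω) (K : ℕ) : Finset (Finset ω) := (badTerms mem jstar T K).image (gmem K)

/-- **THE GEOMETRIC OCCUPANTS OF A TREE SLOT**: the distinct fine members of bad terms whose slot is `s`. [folklore] -/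
def gocc (gmem : ℕ → ι → Finset ω) (gslot : ω → BSlot γ PEv) (K : ℕ) (s : BSlot γ PEv) : Finset ω :=
  (badTerms mem jstar T K).biUnion fun τ => (gmem K τ).filter fun w => gslot w = s

variable {mem jstar T} {gmem : ℕ → ι → Finset ω} {gslot : ω → BSlot γ PEv}

omit [DecidableEq γ] in
/-- membership in the fine classes. [folklore] -/
theorem mem_badGMems {k : Finset ω} :
    k ∈ badGMems mem jstar T gmem K ↔ ∃ τ ∈ badTerms mem jstar T K, gmem K τ = k := mem_image

omit [DecidableEq γ] in
/-- the fine family of a bad term is a fine class. [folklore] -/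
theorem mem_badGMems_of_mem {τ : ι} (hτ : τ ∈ badTerms mem jstar T K) : gmem K τ ∈ badGMems mem jstar T gmem K :=
  mem_image_of_mem _ hτ

/-- membership in the geometric occupants. [folklore] -/
theorem mem_gocc {s : BSlot γ PEv} {w : ω} :
    w ∈ gocc mem jstar T gmem gslot K s ↔ ∃ τ ∈ badTerms mem jstar T K, w ∈ gmem K τ ∧ gslot w = s := by
  simp only [gocc, mem_biUnion, mem_filter]

end TermData

/-! ## §2 The coarse numerator data built from a fine reading -/

section Coarse

variable {ε γ ι ω : Type*} [DecidableEq γ] [DecidableEq ω]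

/-- **THE COARSE DEAD WEIGHT**: the fine dead weight times the fine live factor of the term's fine family. [folklore] -/
def deadC (gmem : ℕ → ι → Finset ω) (FcM : ℕ → Finset ω → ℝ) (dead : ℕ → ℝ → ι → ℝ) (K : ℕ) (t : ℝ) (τ : ι) : ℝ :=
  dead K t τ * FcM K (gmem K τ)

/-- **THE COARSE RESUMMED WEIGHT OF A SLOT FAMILY**: the sum, over the fine classes with that slot family, of
`FcM · RfM` — the PLACEMENT sum, taken in the kernel. [folklore] -/
def RfC (mem : ℕ → ι → Finset (γ × Gen ε)) (jstar : ℕ → ℕ) (T : ℕ → Finset ι) (gmem : ℕ → ι → Finset ω)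
    (gslot : ω → BSlot γ PEv) (FcM RfM : ℕ → Finset ω → ℝ) (K : ℕ) (c : Finset (BSlot γ PEv)) : ℝ :=
  ∑ k ∈ (badGMems mem jstar T gmem K).filter (fun k => k.image gslot = c), FcM K k * RfM K k

variable {sh : ε → PEv} {mem : ℕ → ι → Finset (γ × Gen ε)} {jstar : ℕ → ℕ} {T : ℕ → Finset ι} {l₀ : ℝ} {K₀ : ℕ}
  {gmem : ℕ → ι → Finset ω} {gslot : ω → BSlot γ PEv}
  {A : ℕ → ℝ → ι → ℝ} {dead : ℕ → ℝ → ι → ℝ} {nup : ℕ → ℝ → ℝ} {FcM RfM : ℕ → Finset ω → ℝ}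

/-- **`up` OVER THE COARSE CLASSES FROM `up` OVER THE FINE ONES** (coarse live factor `1`). [folklore] -/
theorem up_coarse
    (upM : ∀ K t, |t| ≤ l₀ → K₀ ≤ K → ∀ k ∈ badGMems mem jstar T gmem K, ∀ τ ∈ fibre gmem T K k,
      A K t τ ≤ dead K t τ * FcM K k * nup K t) :
    ∀ K t, |t| ≤ l₀ → K₀ ≤ K → ∀ c ∈ badClasses sh mem jstar T K, ∀ τ ∈ fibre (bstrOf sh mem) T K c,
      A K t τ ≤ deadC gmem FcM dead K t τ * 1 * nup K t := by
  intro K t ht hK c hc τ hτ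
  obtain ⟨hbad, -⟩ := mem_badTerms_of_mem_fibre hc hτ
  rw [mul_one]
  exact upM K t ht hK (gmem K τ) (mem_badGMems_of_mem hbad) τ (mem_fibre.2 ⟨(mem_fibre.1 hτ).1, rfl⟩)

/-- **THE COARSE DEAD WEIGHT IS NONNEGATIVE** on the fibres of bad classes. [folklore] -/
theorem deadC_nonneg
    (deadM_nonneg : ∀ K t, |t| ≤ l₀ → K₀ ≤ K → ∀ k ∈ badGMems mem jstar T gmem K, ∀ τ ∈ fibre gmem T K k,
      0 ≤ dead K t τ)
    (FM_nonneg : ∀ K t, |t| ≤ l₀ → K₀ ≤ K → ∀ k ∈ badGMems mem jstar T gmem K, 0 ≤ FcM K k) :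
    ∀ K t, |t| ≤ l₀ → K₀ ≤ K → ∀ c ∈ badClasses sh mem jstar T K, ∀ τ ∈ fibre (bstrOf sh mem) T K c,
      0 ≤ deadC gmem FcM dead K t τ := by
  intro K t ht hK c hc τ hτ
  obtain ⟨hbad, -⟩ := mem_badTerms_of_mem_fibre hc hτ
  have hk : gmem K τ ∈ badGMems mem jstar T gmem K := mem_badGMems_of_mem hbad
  exact mul_nonneg (deadM_nonneg K t ht hK _ hk τ (mem_fibre.2 ⟨(mem_fibre.1 hτ).1, rfl⟩))
    (FM_nonneg K t ht hK _ hk)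

/-- **`resum` OVER THE COARSE CLASSES FROM `resum` OVER THE FINE ONES**: when the slot family of every term's fine
family is its coarse class, the fibre of a slot family is the disjoint union, over the fine classes with that slot
family, of their fibres; sum fibrewise. [folklore] -/
theorem resum_coarse
    (hslots : ∀ K, K₀ ≤ K → ∀ τ ∈ T K, (gmem K τ).image gslot = bstrOf sh mem K τ)
    (resumM : ∀ K t, |t| ≤ l₀ → K₀ ≤ K → ∀ k ∈ badGMems mem jstar T gmem K,
      ∑ τ ∈ fibre gmem T K k, dead K t τ ≤ RfM K k)
    (FM_nonneg : ∀ K t, |t| ≤ l₀ → K₀ ≤ K → ∀ k ∈ badGMems mem jstar T gmem K, 0 ≤ FcM K k) :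
    ∀ K t, |t| ≤ l₀ → K₀ ≤ K → ∀ c ∈ badClasses sh mem jstar T K,
      ∑ τ ∈ fibre (bstrOf sh mem) T K c, deadC gmem FcM dead K t τ ≤ RfC mem jstar T gmem gslot FcM RfM K c := by
  intro K t ht hK c hc
  have hmaps : ∀ τ ∈ fibre (bstrOf sh mem) T K c,
      gmem K τ ∈ (badGMems mem jstar T gmem K).filter fun k => k.image gslot = c := by
    intro τ hτ
    obtain ⟨hbad, he⟩ := mem_badTerms_of_mem_fibre hc hτ
    exact mem_filter.2 ⟨mem_badGMems_of_mem hbad, by rw [hslots K hK τ (mem_fibre.1 hτ).1, he]⟩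
  rw [RfC, ← sum_fiberwise_of_maps_to hmaps]
  refine sum_le_sum fun k hk => ?_
  obtain ⟨hkb, hkc⟩ := mem_filter.1 hk
  have hfib : (fibre (bstrOf sh mem) T K c).filter (fun τ => gmem K τ = k) = fibre gmem T K k := by
    ext τ
    simp only [mem_filter, mem_fibre]
    constructor
    · rintro ⟨⟨hT, -⟩, hτk⟩
      exact ⟨hT, hτk⟩
    · rintro ⟨hT, hτk⟩
      refine ⟨⟨hT, ?_⟩, hτk⟩
      rw [← hslots K hK τ hT, hτk, hkc]
  rw [hfib]
  calc ∑ τ ∈ fibre gmem T K k, deadC gmem FcM dead K t τ = FcM K k * ∑ τ ∈ fibre gmem T K k, dead K t τ := by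
        rw [mul_sum]
        refine sum_congr rfl fun τ hτ => ?_
        rw [deadC, (mem_fibre.1 hτ).2, mul_comm]
    _ ≤ FcM K k * RfM K k := mul_le_mul_of_nonneg_left (resumM K t ht hK k hkb) (FM_nonneg K t ht hK k hkb)

end Coarse

/-! ## §3 The summed slot price and its comparison with the labelled price -/

section Price

variable {ε γ ι ω : Type*} [DecidableEq γ] [DecidableEq ε] [DecidableEq ω]

/-- **THE SUMMED PRICE OF A TREE SLOT**: the per-member price summed over the slot's geometric occupants. [folklore] -/
def ySumG (mem : ℕ → ι → Finset (γ × Gen ε)) (jstar : ℕ → ℕ) (T : ℕ → Finset ι) (gmem : ℕ → ι → Finset ω)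
    (gslot : ω → BSlot γ PEv) (p : ℕ → ω → ℝ) (K : ℕ) (s : BSlot γ PEv) : ℝ :=
  ∑ w ∈ gocc mem jstar T gmem gslot K s, p K w

variable {sh : ε → PEv} {mem : ℕ → ι → Finset (γ × Gen ε)} {jstar : ℕ → ℕ} {T : ℕ → Finset ι}
  {gmem : ℕ → ι → Finset ω} {gslot : ω → BSlot γ PEv}
  {C : T4PrintedShapeBanking.Consts} {Λ' : ℝ} {R : ℕ → ℕ → ℕ} {g : ℕ → ℕ → ℝ} {p : ℕ → ω → ℝ} {K : ℕ}

omit [DecidableEq ε] in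
/-- the summed price of a nonnegative price is nonnegative. [folklore] -/
theorem ySumG_nonneg (hp : ∀ w, 0 ≤ p K w) (s : BSlot γ PEv) : 0 ≤ ySumG mem jstar T gmem gslot p K s :=
  sum_nonneg fun w _ => hp w

/-- **SUMMED PRICE ≤ LABELLED PRICE UNDER THE PER-OCCUPANT MULTIPLICITY BOUND**: if at every slot every occupant's
price times the number of occupants is below the slot's labelled price `yT` (the maximum of `priceT` over the named
occupants), then so is the summed price. [folklore] -/
theorem ySumG_le_yT (hΛ : 0 ≤ Λ')
    (hocc : ∀ s, ∀ w ∈ gocc mem jstar T gmem gslot K s,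
      ((gocc mem jstar T gmem gslot K s).card : ℝ) * p K w ≤ bslotPrice (yT sh C Λ' R g mem jstar T K) s)
    (s : BSlot γ PEv) : ySumG mem jstar T gmem gslot p K s ≤ bslotPrice (yT sh C Λ' R g mem jstar T K) s := by
  unfold ySumG
  by_cases hS : (gocc mem jstar T gmem gslot K s).Nonempty
  · have hcard : (0 : ℝ) < (gocc mem jstar T gmem gslot K s).card := by exact_mod_cast hS.card_pos
    have hsum : ((gocc mem jstar T gmem gslot K s).card : ℝ) * ∑ w ∈ gocc mem jstar T gmem gslot K s, p K w ≤
        (gocc mem jstar T gmem gslot K s).card * bslotPrice (yT sh C Λ' R g mem jstar T K) s := by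
      rw [mul_sum]
      refine (sum_le_sum (hocc s)).trans ?_
      rw [sum_const, nsmul_eq_mul]
    exact le_of_mul_le_mul_left hsum hcard
  · rw [not_nonempty_iff_eq_empty.1 hS, sum_empty]
    obtain ⟨j, z, Gs⟩ := s
    exact yT_nonneg hΛ K j z Gs

end Price

/-! ## §4 The per-occupant bound in print's currency -/

section Printed

variable {ε γ : Type*} [DecidableEq ε] {C : T4PrintedShapeBanking.Consts} {O : PrintedO1s}

/-- **MULTIPLICITY × DISCOUNTED PRINTED PRICE ≤ TREE-SLOT PRICE.**  For a member `q = (z, G′)` with a multiplicity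
`N ≤ e^{θ·birthLinT sh G′ + Ξ}·Λm^{partnerAges (PEv.step ∘ sh) G′}`, a printed price `pshapeTH sh O C 1 Λr (R K) (g K) 0 κ G′`
whose realised cost `κ` is read below the model's `costT` on the life, DISCOUNTED by `e^{−Ξ}` (the renewal-entropy
allowance paid on H3's side), the slack `C.a + θ ≤ ½γ₀A₁²` with profile `≥ 1` at the birth steps, and `Λm·Λr ≤ Λ′`:
`N · (pshapeTH · e^{−Ξ}) ≤ priceT sh C Λ′ R g K q`. [folklore] -/
theorem card_mul_pshapeTH_le_priceT (sh : ε → PEv) {θ Λm Λr Λ' : ℝ} (hθ : 0 ≤ θ)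
    (hslack : C.a + θ ≤ O.γ₀ * O.A₁ ^ 2 / 2) (hΛm : 0 ≤ Λm) (hΛr : 0 ≤ Λr) (hΛ : Λm * Λr ≤ Λ')
    (R : ℕ → ℕ → ℕ) (g : ℕ → ℕ → ℝ) (K : ℕ) {q : γ × Gen ε} {κ : Gen ε → ℕ → ℝ} {N Ξ : ℝ}
    (hP1 : ∀ e ∈ q.2.events, (sh e).kind = 0 → 1 ≤ p0Profile C.A₀ C.p₀ (g K (sh e).step))
    (hκ : ∀ n ∈ life (padW (dictWT sh (R K) C.n₁) 0) q.2, κ q.2 n ≤ costT sh C K (R K) q.2 n)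
    (hN : N ≤ Real.exp (θ * birthLinT sh q.2 + Ξ) * Λm ^ partnerAges (PEv.step ∘ sh) q.2) :
    N * (pshapeTH sh O C 1 Λr (R K) (g K) 0 κ q.2 * Real.exp (-Ξ)) ≤ priceT sh C Λ' R g K q := by
  have hps : 0 ≤ pshapeTH sh O C 1 Λr (R K) (g K) 0 κ q.2 := pshapeTH_nonneg sh zero_le_one hΛr _ _ _ _ _
  have h1 : N * (pshapeTH sh O C 1 Λr (R K) (g K) 0 κ q.2 * Real.exp (-Ξ)) ≤
      Real.exp (θ * birthLinT sh q.2 + Ξ) * Λm ^ partnerAges (PEv.step ∘ sh) q.2 *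
        (pshapeTH sh O C 1 Λr (R K) (g K) 0 κ q.2 * Real.exp (-Ξ)) :=
    mul_le_mul_of_nonneg_right hN (mul_nonneg hps (Real.exp_pos _).le)
  have h2 : Real.exp (θ * birthLinT sh q.2 + Ξ) * Λm ^ partnerAges (PEv.step ∘ sh) q.2 *
      (pshapeTH sh O C 1 Λr (R K) (g K) 0 κ q.2 * Real.exp (-Ξ)) =
      Λm ^ partnerAges (PEv.step ∘ sh) q.2 *
        (pshapeTH sh O C 1 Λr (R K) (g K) 0 κ q.2 * Real.exp (θ * birthLinT sh q.2)) := by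
    have e : Real.exp (θ * birthLinT sh q.2 + Ξ) * Real.exp (-Ξ) = Real.exp (θ * birthLinT sh q.2) := by
      rw [← Real.exp_add, add_neg_cancel_right]
    calc _ = Λm ^ partnerAges (PEv.step ∘ sh) q.2 * (pshapeTH sh O C 1 Λr (R K) (g K) 0 κ q.2 *
          (Real.exp (θ * birthLinT sh q.2 + Ξ) * Real.exp (-Ξ))) := by ring
      _ = _ := by rw [e]
  have h3 : pshapeTH sh O C 1 Λr (R K) (g K) 0 κ q.2 * Real.exp (θ * birthLinT sh q.2) ≤
      HistoryConstants.shapeTH sh C 1 Λr (R K) (g K) K 0 q.2 :=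
    pshapeTH_mul_exp_le_shapeTH_of_slack sh hθ hslack zero_le_one hΛr (R K) (g K) K 0 hP1 hκ
  have hE : 0 ≤ Real.exp (-credits (credit C (g K) ∘ sh) q.2) *
      Real.exp (lifeCost (dictWT sh (R K) C.n₁) (costT sh C K (R K)) q.2) := by positivity
  have h4 : Λm ^ partnerAges (PEv.step ∘ sh) q.2 * HistoryConstants.shapeTH sh C 1 Λr (R K) (g K) K 0 q.2 ≤
      priceT sh C Λ' R g K q := by
    rw [shapeTH_zero_one, priceT, ← mul_assoc, ← mul_pow]
    exact mul_le_mul_of_nonneg_right (pow_le_pow_left₀ (mul_nonneg hΛm hΛr) hΛ _) hE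
  calc _ ≤ _ := h1
    _ = _ := h2
    _ ≤ Λm ^ partnerAges (PEv.step ∘ sh) q.2 * HistoryConstants.shapeTH sh C 1 Λr (R K) (g K) K 0 q.2 :=
      mul_le_mul_of_nonneg_left h3 (pow_nonneg hΛm _)
    _ ≤ _ := h4

end Printed

/-! ## §5 The exit's domination binder from the fine price reading -/

section Binders

variable {ε γ ι ω : Type*} [DecidableEq γ] [DecidableEq ε] [DecidableEq ω]
variable {sh : ε → PEv} {C : T4PrintedShapeBanking.Consts} {jstar : ℕ → ℕ} {K₀ : ℕ} {R : ℕ → ℕ → ℕ}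
  {T : ℕ → Finset ι} {mem : ℕ → ι → Finset (γ × Gen ε)} {gmem : ℕ → ι → Finset ω} {gslot : ω → BSlot γ PEv}
  {Λ' : ℝ} {g : ℕ → ℕ → ℝ}

/-- **`hF` FROM THE FINE PRICE READING** (coarse live factor `1`, coarse resummed weight `RfC`, labelled price `yT`):
if the fine live price `FcM·RfM` of the fine family of every bad term is below the product of a nonnegative
per-member price `p` over the family, `gslot` is injective on every fine family, and at every slot
`#occupants · p ≤ yT` per occupant, then `RfC K c ≤ famWeight (bslotPrice (yT … K)) c` for every bad class `c` —
the placement sum is done HERE, by the transversal lemma `HistoryTransversal.sum_prod_le_prod_sum` and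
`ySumG_le_yT`. [folklore] -/
theorem hF_of_multReading (hΛ : 0 ≤ Λ') {l₀ : ℝ}
    (hginj : ∀ K, K₀ ≤ K → ∀ τ ∈ badTerms mem jstar T K, Set.InjOn gslot (gmem K τ : Set ω))
    {p : ℕ → ω → ℝ} (hp : ∀ K w, 0 ≤ p K w)
    (hocc : ∀ K, K₀ ≤ K → ∀ s, ∀ w ∈ gocc mem jstar T gmem gslot K s,
      ((gocc mem jstar T gmem gslot K s).card : ℝ) * p K w ≤ bslotPrice (yT sh C Λ' R g mem jstar T K) s)
    {FcM RfM : ℕ → Finset ω → ℝ}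
    (hPM : ∀ K t, |t| ≤ l₀ → K₀ ≤ K → ∀ τ ∈ badTerms mem jstar T K,
      FcM K (gmem K τ) * RfM K (gmem K τ) ≤ ∏ w ∈ gmem K τ, p K w)
    (K : ℕ) (t : ℝ) (ht : |t| ≤ l₀) (hK : K₀ ≤ K) :
    ∀ c ∈ badClasses sh mem jstar T K,
      (1 : ℝ) * RfC mem jstar T gmem gslot FcM RfM K c ≤ famWeight (bslotPrice (yT sh C Λ' R g mem jstar T K)) c := by
  intro c _
  rw [one_mul, RfC, famWeight]
  calc ∑ k ∈ (badGMems mem jstar T gmem K).filter (fun k => k.image gslot = c), FcM K k * RfM K k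
      ≤ ∑ k ∈ (badGMems mem jstar T gmem K).filter (fun k => k.image gslot = c), ∏ w ∈ k, p K w :=
        sum_le_sum fun k hk => by
          obtain ⟨τ, hτ, rfl⟩ := mem_badGMems.1 (mem_filter.1 hk).1
          exact hPM K t ht hK τ hτ
    _ ≤ ∏ s ∈ c, ySumG mem jstar T gmem gslot p K s :=
        sum_prod_le_prod_sum gslot (gocc mem jstar T gmem gslot K) (p K) (hp K) c
          ((badGMems mem jstar T gmem K).filter (fun k => k.image gslot = c))
          (fun k hk => by
            obtain ⟨τ, hτ, rfl⟩ := mem_badGMems.1 (mem_filter.1 hk).1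
            exact hginj K hK τ hτ)
          (fun k hk => (mem_filter.1 hk).2)
          (fun k hk w hw => by
            obtain ⟨τ, hτ, rfl⟩ := mem_badGMems.1 (mem_filter.1 hk).1
            exact mem_gocc.2 ⟨τ, hτ, hw, rfl⟩)
    _ ≤ ∏ s ∈ c, bslotPrice (yT sh C Λ' R g mem jstar T K) s :=
        prod_le_prod (fun s _ => ySumG_nonneg (hp K) s) fun s _ => ySumG_le_yT hΛ (hocc K hK) s

end Binders

end

end Summit.QuantumFields.BalabanUV.T4Continuum.HistoryAssemblyMult
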